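import Literature.AlgebraicGeometry.Motives.AbelianVarietyWeilPairingPullback
import HarnessLib

/-!
# The mixed-level Weil pairing identity along an isogeny: `ē_M^{Θ_B}(ψ a, ψ b) = ē_{νM}^{Θ_A}(a, b)`

Layer `Literature/AlgebraicGeometry/Motives`, namespace `Literature.AlgebraicGeometry.Motives.AbelianVariety`.
THEOREMS ONLY (no definition, no named fact).  Cell hodgecm-mathlib (D-0151), Hecke-link brick (W′) for (T3)
`SymplecticLiftOfIsogeny` (B-plan1 (g14) 20:23:51Z; owner of (T3) B-p04 (g17), rules-check B-p03 (g15)); count-neutral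
PROOF-lane capital.

Let `ψ : A → B` be a dominant homomorphism of abelian varieties over a field `K`, `Θ_A`, `Θ_B` Cartier divisors on
`A`, `B`, and `ν ≥ 1` with **`φ_{ψ^*Θ_B} = ν · φ_{Θ_A}` on `K`-points** — in the tree's currency
`D_Q(ψ^*Θ_B) ∼ ν · D_Q(Θ_A)` for every `Q ∈ A(K)` (`D_Q(Θ) = t_Q^*Θ − Θ`, ★ `AbelianVariety.weilDiv`), which is the
fibrewise reading of the relation `ψ^∨ ∘ λ_B ∘ ψ = ν · λ_A` between polarisations (Mumford, *Abelian Varieties*, §23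
«descending a polarisation along an isogeny»; [MumfordFogartyKirwan1994] Ch. 6 §2 (6.3)).  Then for `νM`-torsion
points `a, b ∈ A[νM](K)` whose images `ψ a, ψ b` are `M`-torsion:

  **`ē_M^{Θ_B}(ψ a, ψ b) = ē_{νM}^{Θ_A}(a, b)`**   (`weilPairingLevel_map_map_eq_of_mixedLevel`)

— with NO exponent (the single-level functoriality ★ `weilPairingLevel_pullback` only gives the `ν`-th powers of both
sides).  Proof (Mumford §20 properties (1)–(3) of `e_n`, Lang VII §2 Props. 3 and 5, in the tree's Kummer currency):
choose `b′ ∈ A(K)` with `b′^ν = b` (`A(K)` divisible); `ψ b′` is `νM`-torsion and `(ψ b′)^ν = ψ b`, so by skew-symmetry and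
the level compatibility (★ `weilPairingLevel_swap`, ★ `weilPairingLevel_level_mul`)
`ē_M^{Θ_B}(ψ a, ψ b) = ē_{νM}^{Θ_B}(ψ a, ψ b′)`; the latter is the Kummer constant of `a` against
`ψ^* D_{ψ b′}(Θ_B) = D_{b′}(ψ^*Θ_B) ∼ ν D_{b′}(Θ_A) ∼ D_{b′^ν}(Θ_A) = D_b(Θ_A)` (transport of the trivializer along `ψ`,
★ `IsTrivializer.comp_hom`; the hypothesis; the theorem of the square ★ `nsmul_weilDiv_linEquiv`), i.e.
`ē_{νM}^{Θ_A}(a, b)` (★ `weilPairingLevel_eq_kummerConst_of_linEquiv`).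

* §1 `map_pow_eq`, `map_mem_torsionPoints_mul_of_pow` — `ψ(b′^ν) = (ψ b′)^ν`; `ψ b′ ∈ B[νM]` when `b′^ν ∈ A[νM]` maps
  into `B[M]`;
* §2 `weilPairingLevel_eq_of_pow_eq` — **second-variable level change**: `ē_M^Θ(P, Q) = ē_{νM}^Θ(P, Q′)` for `Q′^ν = Q`
  (`P ∈ B[M]`, `Q′ ∈ B[νM]`);
* §3 `weilPairingLevel_map_eq_kummer_transport` — `ē_{νM}^{Θ_B}(ψ a, ψ b′) = e_{νM}(a, D_{b′}(ψ^*Θ_B))` as a Kummer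
  constant (the pattern of ★ `weilPairingLevel_pullback_eq`, valid although `b′` is only `ν²M`-torsion);
* §4 **`weilPairingLevel_map_map_eq_of_mixedLevel`** — the head, in the binder shape of the `hW'` clause of (T3a)
  (B-p04 (g17) census `CENSUS-H3s-QuotientSymplecticLiftable` §2).

## References

* [MumfordAV1970] D. Mumford, *Abelian Varieties* (1970), §20 pp. 183–186 (properties (1)–(3) of `e_n`; `ē^L`), §23
  p. 231 (Thm. 2: descent of polarisations along isogenies and the pairing `e^L` on the kernel).
* [Lang1983AbelianVarieties] S. Lang, *Abelian Varieties*, Ch. VII §2, Props. 3 and 5, Thm. 5 (PDF pp. 138–142).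
* [MumfordFogartyKirwan1994] D. Mumford, J. Fogarty, F. Kirwan, *Geometric Invariant Theory*, 3rd ed., Ch. 6 §2 (6.3)
  (p. 121) and Ch. 7 §2 (p. 130) (polarisations and their pull-backs along homomorphisms).
-/

universe u

open CategoryTheory CategoryTheory.Limits AlgebraicGeometry MonoidalCategory CartesianMonoidalCategory

noncomputable section

namespace Literature.AlgebraicGeometry.Motives

open scoped MonObj
open RatFn

namespace AbelianVariety

variable {K : Type u} [Field K] {A B : AbelianVariety K} (ψ : A ⟶ B)

/-! ### §1 Images of powers and of roots of torsion points -/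

/-- `ψ(Q^n) = (ψ Q)^n` on rational points (a homomorphism of group schemes).
[cite: MumfordAV1970, §4 (Cor. 1 of the rigidity lemma)] -/
theorem map_pow_eq (Q : A.Points K) (n : ℕ) :
    AlgPoints.map ψ.hom.hom.hom (Q ^ n) = (AlgPoints.map ψ.hom.hom.hom Q) ^ n := by
  unfold AlgPoints.map
  rw [← zpow_natCast, GrpObj.zpow_comp, zpow_natCast]

/-- If `b′^ν = b` with `b ∈ A[νM](K)` and `ψ b ∈ B[M](K)`, then `ψ b′ ∈ B[νM](K)`:
`(ψ b′)^{νM} = (ψ b)^M = 1`. [cite: MumfordAV1970, §20 (p. 183)] -/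
theorem map_mem_torsionPoints_mul_of_pow {ν M : ℕ} {b' : A.Points K} {b : A.torsionPoints K ((ν * M : ℕ) : ℤ)}
    (hb' : b' ^ ν = b.1) {Q : B.torsionPoints K M} (hQ : (Q : B.Points K) = AlgPoints.map ψ.hom.hom.hom b.1) :
    AlgPoints.map ψ.hom.hom.hom b' ∈ B.torsionPoints K ((ν * M : ℕ) : ℤ) := by
  rw [mem_torsionPoints_iff, zpow_natCast, pow_mul, ← map_pow_eq, hb', ← hQ]
  exact coe_torsionPoints_pow_eq_one Q

/-! ### §2 Level change in the second variable -/

section LevelChange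

variable {ν M : ℕ} [IsDominant (Hom.toSchemeHom ((M : ℤ) • 𝟙 B))] [IsDominant (Hom.toSchemeHom ((ν : ℤ) • 𝟙 B))]
  [IsDominant (Hom.toSchemeHom (((ν * M : ℕ) : ℤ) • 𝟙 B))]

/-- **Level change in the second variable**: for `P, Q ∈ B[M](K)` and `Q′ ∈ B[νM](K)` with `Q′^ν = Q`,
`ē_M^Θ(P, Q) = ē_{νM}^Θ(P, Q′)` (`P` read in `B[νM]`) — Lang VII §2 Prop. 5 `e_{mn}(a, ξ) = e_n(ma, ξ)` in the FIRST
variable (★ `weilPairingLevel_level_mul`) moved to the second by skew-symmetry (★ `weilPairingLevel_swap`; the points are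
assumed to have `νM`-th roots in `B(K)`, e.g. `K` algebraically closed). [cite: Lang1983AbelianVarieties, Ch. VII §2 Prop. 5 and Thm. 5 (i)] -/
theorem weilPairingLevel_eq_of_pow_eq (Θ : CartierDivisor B.X.left)
    (hdiv : Function.Surjective fun R : B.Points K => R ^ (ν * M))
    (P Q : B.torsionPoints K M) (Q' : B.torsionPoints K ((ν * M : ℕ) : ℤ)) (hQ' : (Q' : B.Points K) ^ ν = Q) :
    B.weilPairingLevel Θ P Q = B.weilPairingLevel (N := ν * M) Θ (B.torsionPointsOfDvd ν P) Q' := by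
  -- roots
  have rootM : ∀ X : B.torsionPoints K M, ∃ R : B.Points K, R ^ M = X.1 := fun X => by
    obtain ⟨R, hR⟩ := hdiv X.1
    exact ⟨R ^ ν, by rw [← pow_mul]; exact hR⟩
  have rootνM : ∀ X : B.torsionPoints K ((ν * M : ℕ) : ℤ), ∃ R : B.Points K, R ^ (ν * M) = X.1 := fun X => hdiv X.1
  -- `Q'^ν = Q` as `M`-torsion points
  have hpow : B.torsionPointsPow ν Q' = Q := Subtype.ext hQ'
  rw [B.weilPairingLevel_swap Θ Q P (rootM Q) (rootM P), ← hpow, ← B.weilPairingLevel_level_mul Θ Q' P,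
    B.weilPairingLevel_swap (N := ν * M) Θ (B.torsionPointsOfDvd ν P) Q' (rootνM _) (rootνM _), inv_inv]

end LevelChange

/-! ### §3 Transport of the Kummer constant along `ψ` -/

section Transport

variable [IsDominant (Hom.toSchemeHom ψ)]
variable {N : ℕ} [IsDominant (Hom.toSchemeHom ((N : ℤ) • 𝟙 A))] [IsDominant (Hom.toSchemeHom ((N : ℤ) • 𝟙 B))]

/-- **`ē_N^{Θ_B}(ψ a, ψ b′) = e_N(a, ψ^* D_{ψ b′}(Θ_B))`**: for `a ∈ A[N](K)` and ANY rational point `b′` of `A` whose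
image `ψ b′` is `N`-torsion, the pairing `ē_N^{Θ_B}(ψ a, ψ b′)` is the Kummer constant of `a` against the pulled-back
divisor `ψ^*(t_{ψb′}^*Θ_B − Θ_B)` trivialized by `ψ^♯ g_{ψ b′}` (Mumford §20 (3) «`e_n(f(x), ŷ) = e_n(x, f̂(ŷ))`»; the
computation of ★ `weilPairingLevel_pullback_eq`, which needs `b′` itself torsion only to NAME the left side).
[cite: MumfordAV1970, §20 (property (3) of e_n, p. 186)] -/
theorem weilPairingLevel_map_eq_kummer_transport (Θ : CartierDivisor B.X.left) (a : A.torsionPoints K N)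
    (b' : A.Points K) (hb' : AlgPoints.map ψ.hom.hom.hom b' ∈ B.torsionPoints K N)
    (P' : B.torsionPoints K N) (hP' : (P' : B.Points K) = AlgPoints.map ψ.hom.hom.hom a.1) :
    B.weilPairingLevel Θ P' ⟨AlgPoints.map ψ.hom.hom.hom b', hb'⟩ =
      kummerConst ((B.isTrivializer_weilFn Θ ⟨AlgPoints.map ψ.hom.hom.hom b', hb'⟩).comp_hom ψ) a := by
  obtain ⟨P'₀, hP'₀⟩ := P'
  subst hP'
  have hg : B.IsTrivializer (n := N) (B.weilDiv Θ (AlgPoints.map ψ.hom.hom.hom b'))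
      (B.weilFn Θ ⟨AlgPoints.map ψ.hom.hom.hom b', hb'⟩) :=
    B.isTrivializer_weilFn Θ ⟨AlgPoints.map ψ.hom.hom.hom b', hb'⟩
  symm
  apply (algebraMap K A.X.left.functionField).injective
  rw [algebraMap_kummerConst]
  -- `t_a^♯ ∘ ψ^♯ = ψ^♯ ∘ t_{ψ a}^♯`
  have ht := translation_left_comp_toSchemeHom ψ a.1
  haveI : IsDominant ((A.translation a.1).left ≫ Hom.toSchemeHom ψ) := inferInstance
  haveI : IsDominant (Hom.toSchemeHom ψ ≫ (B.translation (AlgPoints.map ψ.hom.hom.hom a.1)).left) :=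
    inferInstance
  have hFF : (functionFieldMap (A.translation a.1).left).comp (functionFieldMap (Hom.toSchemeHom ψ)) =
      (functionFieldMap (Hom.toSchemeHom ψ)).comp
        (functionFieldMap (B.translation (AlgPoints.map ψ.hom.hom.hom a.1)).left) := by
    have h := functionFieldMap_congr ht
    rw [functionFieldMap_comp, functionFieldMap_comp] at h
    exact h
  change functionFieldMap (A.translation a.1).left
      (functionFieldMap (Hom.toSchemeHom ψ) (B.weilFn Θ ⟨AlgPoints.map ψ.hom.hom.hom b', hb'⟩)) /
      functionFieldMap (Hom.toSchemeHom ψ) (B.weilFn Θ ⟨AlgPoints.map ψ.hom.hom.hom b', hb'⟩) = _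
  rw [← RingHom.comp_apply (functionFieldMap (A.translation a.1).left), hFF, RingHom.comp_apply,
    ← map_div₀]
  change functionFieldMap (Hom.toSchemeHom ψ)
      (B.translFF (AlgPoints.map ψ.hom.hom.hom a.1) (B.weilFn Θ ⟨AlgPoints.map ψ.hom.hom.hom b', hb'⟩) /
        B.weilFn Θ ⟨AlgPoints.map ψ.hom.hom.hom b', hb'⟩) = _
  rw [← algebraMap_kummerConst hg ⟨AlgPoints.map ψ.hom.hom.hom a.1, map_mem_torsionPoints ψ a.2⟩,
    functionFieldMap_toSchemeHom_algebraMap]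
  rfl

end Transport

/-! ### §4 The mixed-level identity -/

/-- **THE MIXED-LEVEL WEIL-PAIRING IDENTITY ALONG AN ISOGENY** (Mumford §20 (1)–(3), §23; Lang VII §2): let
`ψ : A → B` be a dominant homomorphism with `D_Q(ψ^*Θ_B) ∼ ν · D_Q(Θ_A)` for all `Q ∈ A(K)` (i.e.
`φ_{ψ^*Θ_B} = ν φ_{Θ_A}`, the divisor form of `ψ^∨ λ_B ψ = ν λ_A`), `A(K)` `ν`-divisible and `B(K)` `νM`-divisible (e.g. `K`
algebraically closed).  Then for `a, b ∈ A[νM](K)` with `ψ a = P`, `ψ b = Q` in `B[M](K)`: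
`ē_M^{Θ_B}(P, Q) = ē_{νM}^{Θ_A}(a, b)`.  This is the `hW'` clause of the symplectic-lift transport (T3a) at one geometric
point. [cite: MumfordAV1970, §20 (properties (1)–(3) of e_n, pp. 184–186) and §23 (Thm. 2, p. 231)]
[cite: Lang1983AbelianVarieties, Ch. VII §2 Props. 3 and 5] -/
theorem weilPairingLevel_map_map_eq_of_mixedLevel [IsDominant (Hom.toSchemeHom ψ)] (ΘA : CartierDivisor A.X.left)
    (ΘB : CartierDivisor B.X.left) {ν M : ℕ} [IsDominant (Hom.toSchemeHom ((M : ℤ) • 𝟙 B))]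
    [IsDominant (Hom.toSchemeHom ((ν : ℤ) • 𝟙 B))] [IsDominant (Hom.toSchemeHom (((ν * M : ℕ) : ℤ) • 𝟙 A))]
    [IsDominant (Hom.toSchemeHom (((ν * M : ℕ) : ℤ) • 𝟙 B))]
    (hφ : ∀ Q : A.Points K, (A.weilDiv (ΘB.pullback (Hom.toSchemeHom ψ)) Q).LinEquiv (ν • A.weilDiv ΘA Q))
    (hdivA : Function.Surjective fun R : A.Points K => R ^ ν)
    (hdivB : Function.Surjective fun R : B.Points K => R ^ (ν * M))
    (a b : A.torsionPoints K ((ν * M : ℕ) : ℤ)) (P Q : B.torsionPoints K M)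
    (hP : (P : B.Points K) = AlgPoints.map ψ.hom.hom.hom a.1) (hQ : (Q : B.Points K) = AlgPoints.map ψ.hom.hom.hom b.1) :
    B.weilPairingLevel ΘB P Q = A.weilPairingLevel (N := ν * M) ΘA a b := by
  -- a `ν`-th root `b'` of `b`; its image is `νM`-torsion with `(ψ b')^ν = ψ b = Q`
  obtain ⟨b', hb'⟩ := hdivA b.1
  have hψb' : AlgPoints.map ψ.hom.hom.hom b' ∈ B.torsionPoints K ((ν * M : ℕ) : ℤ) :=
    map_mem_torsionPoints_mul_of_pow ψ hb' hQ
  set Q' : B.torsionPoints K ((ν * M : ℕ) : ℤ) := ⟨AlgPoints.map ψ.hom.hom.hom b', hψb'⟩ with hQ'def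
  have hQ'pow : (Q' : B.Points K) ^ ν = Q := by
    rw [hQ, ← hb', map_pow_eq]
  -- second-variable level change on `B`
  rw [weilPairingLevel_eq_of_pow_eq ΘB hdivB P Q Q' hQ'pow]
  -- `P`, read in `B[νM]`, is `ψ a`
  have hPa : (B.torsionPointsOfDvd ν P : B.Points K) = AlgPoints.map ψ.hom.hom.hom a.1 := hP
  rw [weilPairingLevel_map_eq_kummer_transport ψ ΘB a b' hψb' (B.torsionPointsOfDvd ν P) hPa]
  -- the divisor `ψ^* D_{ψ b'}(Θ_B) = D_{b'}(ψ^*Θ_B) ∼ ν D_{b'}(Θ_A) ∼ D_{b'^ν}(Θ_A) = D_b(Θ_A)`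
  have H : (A.weilDiv ΘA b.1).LinEquiv
      ((B.weilDiv ΘB (AlgPoints.map ψ.hom.hom.hom b')).pullback (Hom.toSchemeHom ψ)) := by
    refine CartierDivisor.LinEquiv.symm ?_
    refine ((weilDiv_pullback_sameDivisor ψ ΘB b').symm.linEquiv.trans (hφ b')).trans ?_
    rw [← hb']
    exact A.nsmul_weilDiv_linEquiv ΘA b' ν
  exact (weilPairingLevel_eq_kummerConst_of_linEquiv (N := ν * M) _ H a).symm

end AbelianVariety

end Literature.AlgebraicGeometry.Motives

end
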